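import Summits.CriticalPhenomena.PercolationContinuityZ3.Theorems.PercNearOneGluingNoHeavyRsw3SlabPlateGluing
import Summits.CriticalPhenomena.PercolationContinuityZ3.Theorems.PercNearOneGluingNoHeavyRsw3SlabSeal
import HarnessLib

/-!
# RSW3 lane (P2, gen 11): PLATE RENORMALISATION — near-certain plate crossings glued by near-certain uniqueness of thin slabs
# percolate: `P_p((boxCross (2n, n, 6n) 0)ᶜ) + P_p(2 ≤ N^sp((n,6n,6n), 0)) ≤ η₀ ⇒ θ(p) > 0`, every `p`

builds on p205010 (kernel theorem, internal audit signed; external expert review pending)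

Cell `prim-rsw3`, prover seat `prim-rsw3-p2` (gen 11), memo `run/shared/lean/prim/rsw3/P2-RSWLITE.md` §17.
Support file (`--supports stmt-CriticalPhenomena-4575`); no definitions, no named facts, no sorries.  Third of the files proving
Aizenman's `D_L(1/6, p_c) > 0` for `ℤ³` (`…Rsw3SlabTwoSpanningCritical`).

THE CELLS (`b ∈ ℤ²`, scale `n ≥ 1`):
* plate `P_b = (n b₀, 2n b₁, 0) + {0..2n} × {0..n} × {0..6n}`, regular if crossed along `x₀` (`C_b`, a `linked` event; source = its face
  `{x₀ = n b₀}`, pairwise disjoint over `b`);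
* slab `β_b = (n b₀ + n, 2n b₁ - 2n, 0) + {0..n} × {0..6n}²` (a translate of `Icc 0 (easyShape 6 n)`), regular if any two open paths
  inside `β_b` between its faces `{x₀ = n b₀ + n}`, `{x₀ = n b₀ + 2n}` are joined inside `β_b` (`U_b`);
* `good b = C_b ∩ U_b`; footprint `(n b₀, 2n b₁ - 2n, 0) + {0..2n} × {0..6n}²`, so cells at sup-distance `> 3` are independent.
`★`-adjacent regular cells glue (`reachable_of_slabUniq_plates` of `…Rsw3SlabPlateGluing`, through `β_b` or `β_{b'}` according to
`b₀ ≤ b'₀` or not), the two failure probabilities are `P((boxCross (2n,n,6n) 0)ᶜ)` (translation) and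
`P(Uniq(Icc 0 (easyShape 6 n))ᶜ) ≤ P(2 ≤ N^sp)` (`preimage_relabel_slabUniqAt`, gen 3's `compl_slabUniq_subset` +
`real_twoSpan_le_real_two_le_blockSpanningCount`), and `theta_pos_of_sparse_bound_wit` (range `r = 3`) concludes:

  `theta_pos_of_plate_slabUniq_criterion`: for every `p` and `n ≥ 1`, if
  `P_p((boxCross (2n, n, 6n) 0)ᶜ) + P_p(2 ≤ blockSpanningCount (easyShape 6 n) 0) ≤ η₀ := δ₃^{16}`, `δ₃ = 1/(2·18·200^{16})`, then `θ(p) > 0`.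

This is Aizenman's criterion (ii) ("if `[1 - R] + D` is too small then there is percolation") with his THINNESS requirement on the
crossing term replaced by the plate crossing, which the slab seal (`…Rsw3SlabSeal`) makes near-certain at `p_c` whenever `D` is small.

References: M. Aizenman, Nucl. Phys. B 485 (1997) 551–582, §2 Thm. 2 and criterion (ii) [Aizenman1997]; G. Grimmett, *Percolation*
(1999), §1.6, §2.2, §7.4 [GrimmettPercolation1999]. [folklore]
-/

noncomputable section

namespace Summit.CriticalPhenomena.PercolationContinuityZ3.Theorems.Rsw3

open MeasureTheory Literature.Probability.LatticeModels Literature.Probability.Percolation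
open Literature.Probability.Percolation.KestenZhang Literature.Probability.Percolation.KozmaNitzan SimpleGraph Relation
open Summit.CriticalPhenomena.PercolationContinuityZ3.Theorems.Crossing SurfaceTension

/-! ## Geometry of the cells -/

/-- `sup`-distance `≤ 1` on `ℤ²`, scaled: `|n b₀ - n b'₀| ≤ n` and `|2n b₁ - 2n b'₁| ≤ 2n`. [folklore] -/
theorem mul_bounds_of_supDist_le_one {n : ℕ} {b b' : Site 2} (h : supDist b b' ≤ 1) :
    ((n : ℤ) * b' 0 - n ≤ (n : ℤ) * b 0 ∧ (n : ℤ) * b 0 ≤ (n : ℤ) * b' 0 + n) ∧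
      (2 * (n : ℤ) * b' 1 - 2 * (n : ℤ) ≤ 2 * (n : ℤ) * b 1 ∧ 2 * (n : ℤ) * b 1 ≤ 2 * (n : ℤ) * b' 1 + 2 * (n : ℤ)) := by
  have hn : (0 : ℤ) ≤ n := by positivity
  have e0 := abs_sub_le_one_of_supDist_le_one h 0
  have e1 := abs_sub_le_one_of_supDist_le_one h 1
  have a := mul_le_mul_of_nonneg_left e0.1 hn
  have a' := mul_le_mul_of_nonneg_left e0.2 hn
  have c := mul_le_mul_of_nonneg_left e1.1 (by positivity : (0 : ℤ) ≤ 2 * (n : ℤ))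
  have c' := mul_le_mul_of_nonneg_left e1.2 (by positivity : (0 : ℤ) ≤ 2 * (n : ℤ))
  refine ⟨⟨by linarith, by linarith⟩, by linarith, by linarith⟩

/-- **Footprints of cells at sup-distance `> 3` are disjoint**: the boxes `(n b₀, 2n b₁ - 2n, 0) + {0..2n} × {0..6n}²`, `n ≥ 1`. [folklore] -/
theorem disjoint_plateFootprint_of_lt_supDist {n : ℕ} (hn : 1 ≤ n) {b b' : Site 2} (h : 3 < supDist b b') :
    Disjoint ((Finset.Icc (0 : Site 3) ![2 * (n : ℤ), 6 * (n : ℤ), 6 * (n : ℤ)]).image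
        (· + ![(n : ℤ) * b 0, 2 * (n : ℤ) * b 1 - 2 * (n : ℤ), 0]))
      ((Finset.Icc (0 : Site 3) ![2 * (n : ℤ), 6 * (n : ℤ), 6 * (n : ℤ)]).image
        (· + ![(n : ℤ) * b' 0, 2 * (n : ℤ) * b' 1 - 2 * (n : ℤ), 0])) := by
  rw [Finset.disjoint_left]
  intro x hx hx'
  rw [mem_image_Icc_add_iff] at hx hx'
  have hn0 : (0 : ℤ) < n := by exact_mod_cast hn
  have hx0 := hx 0; have hx'0 := hx' 0; have hx1 := hx 1; have hx'1 := hx' 1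
  simp at hx0 hx'0 hx1 hx'1
  have key0 : ∀ {c c' : ℤ}, (n : ℤ) * c ≤ 2 * (n : ℤ) + (n : ℤ) * c' → c ≤ c' + 2 := by
    intro c c' h1
    by_contra hc
    push Not at hc
    have h3 : c' + 3 ≤ c := by omega
    nlinarith
  have key1 : ∀ {c c' : ℤ}, 2 * (n : ℤ) * c - 2 * (n : ℤ) ≤ 6 * (n : ℤ) + (2 * (n : ℤ) * c' - 2 * (n : ℤ)) → c ≤ c' + 3 := by
    intro c c' h1
    by_contra hc
    push Not at hc
    have h3 : c' + 4 ≤ c := by omega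
    nlinarith
  have a0 : b 0 ≤ b' 0 + 2 := key0 (by linarith [hx0.1, hx'0.2])
  have a0' : b' 0 ≤ b 0 + 2 := key0 (by linarith [hx'0.1, hx0.2])
  have a1 : b 1 ≤ b' 1 + 3 := key1 (by linarith [hx1.1, hx'1.2])
  have a1' : b' 1 ≤ b 1 + 3 := key1 (by linarith [hx'1.1, hx1.2])
  have hle : supDist b b' ≤ 3 := by
    rw [supDist_le_iff]
    intro i
    fin_cases i
    · show (b 0 - b' 0).natAbs ≤ 3; omega
    · show (b 1 - b' 1).natAbs ≤ 3; omega
  omega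

/-! ## The criterion -/

/-- **Plate renormalisation (every `p`, every `n ≥ 1`).**  With `δ₃ = 1/(2·((3+1)²+2)·(2·(3²+1)²)^{(3+1)²})`: if
`P_p((boxCross (2n, n, 6n) 0)ᶜ) + P_p(2 ≤ blockSpanningCount (easyShape 6 n) 0) ≤ δ₃^{(3+1)²}`
(the box `{0..2n} × {0..n} × {0..6n}` crossed ALONG its side `2n`, and the slab-box `{0..n} × {0..6n}²` with at most one spanning
cluster, both near-certain), then `θ(p) > 0`.  Cells: plates `(n b₀, 2n b₁, 0) + {0..2n} × {0..n} × {0..6n}` crossed along `x₀`,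
glued by the uniqueness of the slabs `(n b₀ + n, 2n b₁ - 2n, 0) + {0..n} × {0..6n}²` (`reachable_of_slabUniq_plates`); range `3`;
`theta_pos_of_sparse_bound_wit`.  Aizenman's criterion (ii) without the thinness of the cells.
[cite: Aizenman1997, §2 criterion (ii) ("if (1 - R) + D is too small then there is percolation")] -/
theorem theta_pos_of_plate_slabUniq_criterion (p : unitInterval) {n : ℕ} (hn : 1 ≤ n)
    (h : (bondPercolation (zdGraph 3) p).real (boxCross ![2 * (n : ℤ), n, 6 * (n : ℤ)] 0)ᶜ +
        (bondPercolation (zdGraph 3) p).real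
          {ω : BondConfig (Site 3) | ∃ x ∈ Finset.Icc (0 : Site 3) (easyShape 6 n), ∃ x' ∈ Finset.Icc (0 : Site 3) (easyShape 6 n),
            ∃ y ∈ Finset.Icc (0 : Site 3) (easyShape 6 n), ∃ y' ∈ Finset.Icc (0 : Site 3) (easyShape 6 n),
            x 0 = 0 ∧ x' 0 = 0 ∧ y 0 = (n : ℤ) ∧ y' 0 = (n : ℤ) ∧
            ω ∈ inConn ↑(Finset.Icc (0 : Site 3) (easyShape 6 n)) x y ∧
            ω ∈ inConn ↑(Finset.Icc (0 : Site 3) (easyShape 6 n)) x' y' ∧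
            ω ∉ inConn ↑(Finset.Icc (0 : Site 3) (easyShape 6 n)) x x'} ≤
      (1 / (2 * ((3 + 1) ^ 2 + 2 : ℝ) * (2 * (3 ^ 2 + 1 : ℝ) ^ 2) ^ ((3 + 1) ^ 2))) ^ ((3 + 1) ^ 2)) :
    0 < theta (zdGraph 3) (0 : Site 3) p := by
  classical
  set μ := bondPercolation (zdGraph 3) p with hμ
  set δ : ℝ := 1 / (2 * ((3 + 1) ^ 2 + 2 : ℝ) * (2 * (3 ^ 2 + 1 : ℝ) ^ 2) ^ ((3 + 1) ^ 2)) with hδ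
  have hn0 : (0 : ℤ) ≤ n := by positivity
  have hn1 : (0 : ℤ) < n := by exact_mod_cast hn
  -- base regions
  set L : Site 3 := ![2 * (n : ℤ), n, 6 * (n : ℤ)] with hL
  set plate₀ : Finset (Site 3) := Finset.Icc (0 : Site 3) L with hplate₀
  set F0 : Set (Site 3) := {x | x ∈ plate₀ ∧ x 0 = 0} with hF0
  set F1 : Set (Site 3) := {x | x ∈ plate₀ ∧ x 0 = L 0} with hF1
  set slab₀ : Finset (Site 3) := Finset.Icc (0 : Site 3) (easyShape 6 n) with hslab₀
  set V₀ : Finset (Site 3) := Finset.Icc (0 : Site 3) ![2 * (n : ℤ), 6 * (n : ℤ), 6 * (n : ℤ)] with hV₀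
  have hL0 : L 0 = 2 * (n : ℤ) := by simp [hL]
  -- shifts
  set w : Site 2 → Site 3 := fun b => ![(n : ℤ) * b 0, 2 * (n : ℤ) * b 1, 0] with hw
  set u : Site 2 → Site 3 := fun b => ![(n : ℤ) * b 0 + n, 2 * (n : ℤ) * b 1 - 2 * (n : ℤ), 0] with hu
  set f : Site 2 → Site 3 := fun b => ![(n : ℤ) * b 0, 2 * (n : ℤ) * b 1 - 2 * (n : ℤ), 0] with hf
  have hw0 : ∀ b, w b 0 = (n : ℤ) * b 0 := fun b => by simp [hw]
  have hw1 : ∀ b, w b 1 = 2 * (n : ℤ) * b 1 := fun b => by simp [hw]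
  have hw2 : ∀ b, w b 2 = 0 := fun b => by simp [hw]
  have hu0 : ∀ b, u b 0 = (n : ℤ) * b 0 + n := fun b => by simp [hu]
  -- cells
  set plate : Site 2 → Finset (Site 3) := fun b => plate₀.image (· + w b) with hplate
  set β : Site 2 → Finset (Site 3) := fun b => slab₀.image (· + u b) with hβ
  set V : Site 2 → Finset (Site 3) := fun b => V₀.image (· + f b) with hV
  set C : Site 2 → Set (BondConfig (Site 3)) := fun b =>
    linked ((zdShiftIso (w b)) '' (↑plate₀ : Set (Site 3))) ((zdShiftIso (w b)) '' F0) ((zdShiftIso (w b)) '' F1) with hC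
  set U : Site 2 → Set (BondConfig (Site 3)) := fun b =>
    {ω : BondConfig (Site 3) | ∀ x ∈ slab₀.image (· + u b), ∀ x' ∈ slab₀.image (· + u b), ∀ y ∈ slab₀.image (· + u b),
      ∀ y' ∈ slab₀.image (· + u b), x 0 = u b 0 → x' 0 = u b 0 → y 0 = u b 0 + (n : ℤ) → y' 0 = u b 0 + (n : ℤ) →
      ω ∈ inConn ↑(slab₀.image (· + u b)) x y → ω ∈ inConn ↑(slab₀.image (· + u b)) x' y' →
      ω ∈ inConn ↑(slab₀.image (· + u b)) x x'} with hUdef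
  set good : Site 2 → Set (BondConfig (Site 3)) := fun b => C b ∩ U b with hgood
  set src : Site 2 → Set (Site 3) := fun b => (zdShiftIso (w b)) '' F0 with hsrc
  set Wit : BondConfig (Site 3) → Site 2 → Site 3 → Prop := fun ω b x =>
    x 0 = (n : ℤ) * b 0 ∧ x ∈ plate b ∧ ∃ y : Site 3, y 0 = (n : ℤ) * b 0 + 2 * (n : ℤ) ∧ ω ∈ inConn ↑(plate b) x y with hWit
  have himg_plate : ∀ b, (zdShiftIso (w b)) '' (↑plate₀ : Set (Site 3)) = ↑(plate b) := by
    intro b; simp only [hplate]; rw [Finset.coe_image]; rfl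
  have hmem_plate₀ : ∀ x : Site 3, x ∈ plate₀ ↔
      (0 ≤ x 0 ∧ x 0 ≤ 2 * (n : ℤ)) ∧ (0 ≤ x 1 ∧ x 1 ≤ n) ∧ (0 ≤ x 2 ∧ x 2 ≤ 6 * (n : ℤ)) := by
    intro x; rw [hplate₀, hL]; exact mem_Icc_zero_vec3_iff
  -- the source at the origin, as a finset
  set src₀ : Finset (Site 3) := (plate₀.filter fun x => x 0 = 0).image (· + w 0) with hsrc₀
  have hsrc0 : src 0 = ↑src₀ := by
    simp only [hsrc, hsrc₀]
    rw [Finset.coe_image, Finset.coe_filter]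
    ext x
    simp only [Set.mem_image, Set.mem_setOf_eq, hF0, zdShiftIso_apply]
  have hne : src₀.Nonempty := by
    refine (Finset.image_nonempty).2 ⟨0, ?_⟩
    rw [Finset.mem_filter, hmem_plate₀]
    refine ⟨?_, rfl⟩
    simp only [Pi.zero_apply]
    refine ⟨⟨le_rfl, by positivity⟩, ⟨le_rfl, hn0⟩, le_rfl, by positivity⟩
  -- smallness of `δ`
  have hδ0 : 0 ≤ δ := by rw [hδ]; positivity
  have hδ1 : 2 * ((3 + 1) ^ 2 + 2 : ℝ) * (2 * (3 ^ 2 + 1 : ℝ) ^ 2) ^ ((3 + 1) ^ 2) * δ ≤ 1 := by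
    have hpos : 0 < 2 * ((3 + 1) ^ 2 + 2 : ℝ) * (2 * (3 ^ 2 + 1 : ℝ) ^ 2) ^ ((3 + 1) ^ 2) := by positivity
    rw [hδ, mul_one_div_cancel hpos.ne']
  refine theta_pos_of_sparse_bound_wit p (src := src) (good := good) (Wit := Wit) src₀ hsrc0 hne ?_ ?_ ?_
    (r := 3) hδ0 hδ1 ?_
  · -- a regular cell is crossed from its source
    intro ω b hb
    obtain ⟨hcr, -⟩ := hb
    have hcr' : ω ∈ linked ((zdShiftIso (w b)) '' (↑plate₀ : Set (Site 3))) ((zdShiftIso (w b)) '' F0)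
        ((zdShiftIso (w b)) '' F1) := hcr
    rw [mem_linked_iff] at hcr'
    obtain ⟨x, hx, _, ⟨y₀, ⟨hy₀, hy₀0⟩, rfl⟩, hxy⟩ := hcr'
    refine ⟨x, hx, ?_, ?_, (zdShiftIso (w b)) y₀, ?_, ?_⟩
    · obtain ⟨x₀, ⟨-, hx₀0⟩, rfl⟩ := hx
      rw [zdShiftIso_apply, Pi.add_apply, hx₀0, hw0, zero_add]
    · obtain ⟨x₀, ⟨hx₀, -⟩, rfl⟩ := hx
      rw [← Finset.mem_coe, ← himg_plate b]
      exact ⟨x₀, Finset.mem_coe.2 hx₀, rfl⟩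
    · rw [zdShiftIso_apply, Pi.add_apply, hy₀0, hL0, hw0]; ring
    · rw [← himg_plate b]; exact hxy
  · -- gluing of ★-neighbours
    intro ω b b' hbb' hb hb' x x' hWx hWx'
    obtain ⟨hx0, hx, y, hy0, hxy⟩ := hWx
    obtain ⟨hx'0, hx', y', hy'0, hx'y'⟩ := hWx'
    obtain ⟨⟨e0, e0'⟩, e1, e1'⟩ := mul_bounds_of_supDist_le_one (n := n) hbb'
    rcases le_or_gt (b 0) (b' 0) with hle | hlt
    · have hk : (n : ℤ) * b 0 ≤ (n : ℤ) * b' 0 := mul_le_mul_of_nonneg_left hle hn0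
      exact reachable_of_slabUniq_plates (n := n) (k₀ := (n : ℤ) * b 0) (k₀' := (n : ℤ) * b' 0)
        (k₁ := 2 * (n : ℤ) * b 1) (k₁' := 2 * (n : ℤ) * b' 1) hk (by linarith) (by linarith) (by linarith) hb.2 hx0 hy0 hx'0
        hy'0 hx hx' hxy hx'y'
    · have hk : (n : ℤ) * b' 0 ≤ (n : ℤ) * b 0 := mul_le_mul_of_nonneg_left hlt.le hn0
      exact (reachable_of_slabUniq_plates (n := n) (k₀ := (n : ℤ) * b' 0) (k₀' := (n : ℤ) * b 0)
        (k₁ := 2 * (n : ℤ) * b' 1) (k₁' := 2 * (n : ℤ) * b 1) hk (by linarith) (by linarith) (by linarith)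
        hb'.2 hx'0 hy'0 hx0 hy0 hx' hx hx'y' hxy).symm
  · -- distinct cells have disjoint sources
    intro b b' x hx hx'
    obtain ⟨a, ⟨ha, ha0⟩, rfl⟩ := hx
    obtain ⟨a', ⟨ha', ha'0⟩, he⟩ := hx'
    rw [zdShiftIso_apply] at he
    have he' : ∀ i, a' i + w b' i = a i + w b i := fun i => by
      have := congrArg (fun z : Site 3 => z i) he; simpa [zdShiftIso_apply] using this
    have h0 := he' 0; have h1 := he' 1
    rw [hw0, hw0, ha0, ha'0, zero_add, zero_add] at h0
    rw [hw1, hw1] at h1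
    obtain ⟨-, ⟨ha1, ha1'⟩, -⟩ := (hmem_plate₀ a).1 ha
    obtain ⟨-, ⟨ha'1, ha'1'⟩, -⟩ := (hmem_plate₀ a').1 ha'
    have hb0 : b 0 = b' 0 := by
      rcases lt_trichotomy (b 0) (b' 0) with hlt | heq | hgt
      · have : (n : ℤ) * b 0 < (n : ℤ) * b' 0 := mul_lt_mul_of_pos_left hlt hn1
        omega
      · exact heq
      · have : (n : ℤ) * b' 0 < (n : ℤ) * b 0 := mul_lt_mul_of_pos_left hgt hn1
        omega
    have hb1 : b 1 = b' 1 := by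
      rcases lt_trichotomy (b 1) (b' 1) with hlt | heq | hgt
      · have h2 : b 1 + 1 ≤ b' 1 := hlt
        have := mul_le_mul_of_nonneg_left h2 (by positivity : (0 : ℤ) ≤ 2 * (n : ℤ))
        nlinarith
      · exact heq
      · have h2 : b' 1 + 1 ≤ b 1 := hgt
        have := mul_le_mul_of_nonneg_left h2 (by positivity : (0 : ℤ) ≤ 2 * (n : ℤ))
        nlinarith
    funext i
    fin_cases i
    · exact hb0
    · exact hb1
  · -- the sparse product bound
    intro T hT
    -- locality
    have hplateV : ∀ b, plate b ⊆ V b := by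
      intro b x hx
      simp only [hplate, hV] at hx ⊢
      rw [mem_image_Icc_add_iff] at hx ⊢
      intro i
      have := hx i
      fin_cases i
      · simp [hL, hw, hf] at this ⊢; exact this
      · simp [hL, hw, hf] at this ⊢; constructor <;> linarith [this.1, this.2]
      · simp [hL, hw, hf] at this ⊢; exact this
    have hβV : ∀ b, β b ⊆ V b := by
      intro b x hx
      simp only [hβ, hV] at hx ⊢
      rw [mem_image_Icc_add_iff] at hx ⊢
      intro i
      have := hx i
      fin_cases i
      · simp [easyShape, hu, hf] at this ⊢; constructor <;> linarith [this.1, this.2]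
      · simp [easyShape, hu, hf] at this ⊢; exact this
      · simp [easyShape, hu, hf] at this ⊢; exact this
    have hdetC : ∀ b, DeterminedBy (C b) (↑(edgesIn (zdGraph 3) (V b)) : Set (Sym2 (Site 3))) := by
      intro b
      show DeterminedBy (linked ((zdShiftIso (w b)) '' (↑plate₀ : Set (Site 3))) ((zdShiftIso (w b)) '' F0)
        ((zdShiftIso (w b)) '' F1)) _
      rw [himg_plate b]
      exact (determinedBy_linked_edgesIn (plate b) _ _).mono (coe_edgesIn_mono (hplateV b))
    have hdetU : ∀ b, DeterminedBy (U b) (↑(edgesIn (zdGraph 3) (V b)) : Set (Sym2 (Site 3))) := by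
      intro b
      exact (determinedBy_slabUniqAt n (u b 0) (β b)).mono (coe_edgesIn_mono (hβV b))
    have hdet : ∀ b ∈ T, DeterminedBy (good b)ᶜ (↑(edgesIn (zdGraph 3) (V b)) : Set (Sym2 (Site 3))) :=
      fun b _ => ((hdetC b).inter (hdetU b)).compl'
    have hdisj : (↑T : Set (Site 2)).PairwiseDisjoint
        (fun b => (↑(edgesIn (zdGraph 3) (V b)) : Set (Sym2 (Site 3)))) := by
      intro b hb b' hb' hne'
      exact disjoint_edgesIn_of_disjoint (disjoint_plateFootprint_of_lt_supDist hn (hT b hb b' hb' hne'))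
    rw [bondPercolation_real_biInter_eq_prod (zdGraph 3) p T (fun b => (good b)ᶜ) _ hdet
      (fun b hb => (hdet b hb).measurableSet_of_finset) hdisj]
    -- each factor is at most `δ^16`
    have hCm : ∀ b, MeasurableSet (C b) := fun b => measurableSet_linked _ _ _
    have hUm : ∀ b, MeasurableSet (U b) := fun b => (determinedBy_slabUniqAt n (u b 0) (β b)).measurableSet_of_finset
    have hPC : ∀ b, μ.real (C b)ᶜ ≤ μ.real (boxCross L 0)ᶜ := by
      intro b
      have himg := real_linked_image (zdShiftIso (w b)) p (↑plate₀ : Set (Site 3)) F0 F1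
      rw [← hμ] at himg
      have e : μ.real (C b) = μ.real (linked (↑plate₀ : Set (Site 3)) F0 F1) := by rw [hC]; exact himg
      have hle : μ.real (boxCross L 0) ≤ μ.real (linked (↑plate₀ : Set (Site 3)) F0 F1) := by
        rw [hF0, hF1, hplate₀]; exact real_boxCross_le_real_linked_faces p L 0
      rw [probReal_compl_eq_one_sub (hCm b), probReal_compl_eq_one_sub (measurableSet_boxCross L 0), e]
      linarith
    have hPU : ∀ b, μ.real (U b)ᶜ ≤ μ.real
        {ω : BondConfig (Site 3) | ∃ x ∈ slab₀, ∃ x' ∈ slab₀, ∃ y ∈ slab₀, ∃ y' ∈ slab₀,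
          x 0 = 0 ∧ x' 0 = 0 ∧ y 0 = (n : ℤ) ∧ y' 0 = (n : ℤ) ∧
          ω ∈ inConn ↑slab₀ x y ∧ ω ∈ inConn ↑slab₀ x' y' ∧ ω ∉ inConn ↑slab₀ x x'} := by
      intro b
      have hrel := bondPercolation_real_preimage_relabel_iso (zdShiftIso (u b)) p (U b)ᶜ
      rw [Set.preimage_compl] at hrel
      have hpre : BondConfig.relabel (sym2Equiv (zdShiftIso (u b)).toEquiv) ⁻¹' (U b) =
          {ω | ∀ x ∈ slab₀, ∀ x' ∈ slab₀, ∀ y ∈ slab₀, ∀ y' ∈ slab₀, x 0 = 0 → x' 0 = 0 → y 0 = (n : ℤ) → y' 0 = (n : ℤ) →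
            ω ∈ inConn ↑slab₀ x y → ω ∈ inConn ↑slab₀ x' y' → ω ∈ inConn ↑slab₀ x x'} :=
        preimage_relabel_slabUniqAt n slab₀ (u b)
      rw [hpre, ← hμ] at hrel
      rw [← hrel]
      exact measureReal_mono (compl_slabUniq_subset n slab₀) (measure_ne_top _ _)
    have hfac : ∀ b ∈ T, μ.real (good b)ᶜ ≤ δ ^ ((3 + 1) ^ 2) := by
      intro b _
      have : μ.real (good b)ᶜ ≤ μ.real (C b)ᶜ + μ.real (U b)ᶜ := by
        simp only [hgood]; rw [Set.compl_inter]; exact measureReal_union_le _ _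
      refine this.trans ((add_le_add (hPC b) (hPU b)).trans ?_)
      rw [hL]; exact h
    calc ∏ b ∈ T, μ.real (good b)ᶜ ≤ ∏ _b ∈ T, δ ^ ((3 + 1) ^ 2) :=
          Finset.prod_le_prod (fun b _ => measureReal_nonneg) hfac
      _ = δ ^ ((3 + 1) ^ 2 * T.card) := by rw [Finset.prod_const, ← pow_mul]

/-- **Plate renormalisation, counting form.**  If `P_p((boxCross (2n, n, 6n) 0)ᶜ) + P_p(2 ≤ blockSpanningCount (easyShape 6 n) 0) ≤ δ₃^{16}`
for some `n ≥ 1`, then `θ(p) > 0` (the `TwoSpan` event of the slab-box lies, almost surely, inside `{2 ≤ N^sp}`,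
`real_twoSpan_le_real_two_le_blockSpanningCount`). [cite: Aizenman1997, §2 criterion (ii) and §5 (N_Free)] -/
theorem theta_pos_of_plate_blockSpanningCount_criterion (p : unitInterval) {n : ℕ} (hn : 1 ≤ n)
    (h : (bondPercolation (zdGraph 3) p).real (boxCross ![2 * (n : ℤ), n, 6 * (n : ℤ)] 0)ᶜ +
        (bondPercolation (zdGraph 3) p).real {ω | 2 ≤ blockSpanningCount (easyShape 6 n) 0 ω} ≤
      (1 / (2 * ((3 + 1) ^ 2 + 2 : ℝ) * (2 * (3 ^ 2 + 1 : ℝ) ^ 2) ^ ((3 + 1) ^ 2))) ^ ((3 + 1) ^ 2)) :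
    0 < theta (zdGraph 3) (0 : Site 3) p :=
  theta_pos_of_plate_slabUniq_criterion p hn
    ((add_le_add le_rfl
      (real_twoSpan_le_real_two_le_blockSpanningCount p (L := easyShape 6 n) (n := n) (by simp [easyShape]))).trans h)

end Summit.CriticalPhenomena.PercolationContinuityZ3.Theorems.Rsw3

end
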